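import Literature.Computability.QuantumComplexity.PseudoBounded
import Literature.Computability.QuantumComplexity.InfluenceBounds
import Literature.Computability.Complexity.BooleanFourier

/-!
# Route `SosSandwich`: the subcube obstruction to pseudo-boundedness

A structural reading of the gate-aa-sos antipodal counterexamples (files
`SosSandwichAntipodalNotPseudoBounded*`): membership in the sandwich class `K_T` (`PseudoBounded T`)
is not a matter of degree but of LOCAL certificate complexity. If `p` — or `1 - p` — restricted to some
subcube of dimension `> T` is supported on a single point (an "isolated" nonzero value), then `p` is not
pseudo-bounded of order `T`, whatever its total degree. The engine is the general face lemma
`evalBool_eq_zero_of_vanish_on_subcube`: a polynomial of total degree `< d` that vanishes on a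
`d`-dimensional subcube minus one point vanishes at that point too (the Walsh coefficient of the
restriction at the top set vanishes by degree — O'Donnell Prop. 3.21, `cubeFourierCoeff_piecewise` — and
equals `± 2^{-d} ·` the missing value). Consequences: a Boolean function with an `AND_{T+1}` or `OR_{T+1}`
subfunction (any point indicator of a `(T+1)`-subcube, up to negating inputs and output) is outside `K_T`;
the selectors `y_k ? AND_k : OR_k` and every `[0,1]`-valued `p` equal to `1` on a `(T+1)`-subcube except at
one point are outside `K_T`. This is the hereditary condition («every restriction of `p` and of `1 - p` has
sum-of-squares degree `≤ T`», Kaniewski–Lee–de Wolf's `QE ≤ T` for both) that plain boundedness + degree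
hypotheses (AA, AA restricted to odd polynomials) do not supply.
-/

set_option linter.dupNamespace false -- D-0017: single-problem summit ⇒ `QuantumAdvantage.QuantumAdvantage` by design

namespace Summit.QuantumAdvantage.QuantumAdvantage.Theorems.SosSandwich

open Finset MvPolynomial Literature.Computability.QuantumComplexity
  Literature.Computability.Complexity.LowDegree Literature.Probability.RandomGraphs.LowDegree

/-- **Face lemma (general subcube).** If `r` has total degree `< |D|` and its cube values vanish at every
point that agrees with `a` outside `D` except possibly at `a` itself, then `r(a) = 0` as well. Proof: the
restriction `G(x) = r(x ← a outside D)` has Walsh coefficient `0` at `D` (each contributing coefficient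
`r̂(S)`, `S ⊇ D`, vanishes by degree, `cubeFourierCoeff_piecewise` + `cubeFourierCoeff_evalBool_eq_zero`),
while directly `2^N · Ĝ(D) = #{x ≡ a on D} · r(a) · χ_D(a)`. [folklore] -/
theorem evalBool_eq_zero_of_vanish_on_subcube {N : ℕ} (D : Finset (Fin N))
    (r : MvPolynomial (Fin N) ℝ) (hr : r.totalDegree < D.card) (a : Fin N → Bool)
    (h0 : ∀ x : Fin N → Bool, (∀ i, i ∉ D → x i = a i) → x ≠ a → evalBool r x = 0) :
    evalBool r a = 0 := by
  classical
  set J : Finset (Fin N) := Dᶜ with hJ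
  have hJmem : ∀ i, i ∈ J ↔ i ∉ D := fun i => by rw [hJ, Finset.mem_compl]
  -- (1) the Walsh coefficient of the restriction at `D` vanishes, by degree
  have hcoef : cubeFourierCoeff (fun x => evalBool r (J.piecewise a x)) D = 0 := by
    rw [cubeFourierCoeff_piecewise]
    refine Finset.sum_eq_zero fun S _ => ?_
    split_ifs with hS
    · have hsub : D ⊆ S := by
        intro i hi
        have : i ∈ S.filter (· ∉ J) := by rw [hS]; exact hi
        exact (Finset.mem_filter.mp this).1
      rw [cubeFourierCoeff_evalBool_eq_zero (le_refl _) (hr.trans_le (Finset.card_le_card hsub)), zero_mul]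
    · rfl
  -- (2) pointwise: the restriction is `r(a)` where `x ≡ a` on `D`, and `0` elsewhere (hypothesis)
  have hGx : ∀ x : Fin N → Bool, evalBool r (J.piecewise a x) =
      if (∀ i ∈ D, x i = a i) then evalBool r a else 0 := by
    intro x
    by_cases hx : ∀ i ∈ D, x i = a i
    · rw [if_pos hx]
      have : J.piecewise a x = a := by
        funext i
        by_cases hi : i ∈ J
        · rw [Finset.piecewise_eq_of_mem _ _ _ hi]
        · rw [Finset.piecewise_eq_of_notMem _ _ _ hi]; exact hx i (by rwa [hJmem, not_not] at hi)
      rw [this]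
    · rw [if_neg hx]
      apply h0
      · intro i hi
        exact Finset.piecewise_eq_of_mem _ _ _ ((hJmem i).mpr hi)
      · intro heq
        apply hx
        intro i hi
        have := congrFun heq i
        rwa [Finset.piecewise_eq_of_notMem _ _ _ (fun h => (hJmem i).mp h hi)] at this
  -- characters of `D` only see the `D`-coordinates
  have hwal : ∀ x : Fin N → Bool, (∀ i ∈ D, x i = a i) → walsh D x = walsh D a := by
    intro x hx; unfold walsh; exact Finset.prod_congr rfl fun i hi => by rw [hx i hi]
  -- (3) the defining sum of the coefficient is `#{x ≡ a on D} · r(a) χ_D(a)`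
  have hsum : ∑ x : Fin N → Bool, evalBool r (J.piecewise a x) * walsh D x =
      ((Finset.univ.filter fun x : Fin N → Bool => ∀ i ∈ D, x i = a i).card : ℝ) *
        (evalBool r a * walsh D a) := by
    have : ∀ x : Fin N → Bool, evalBool r (J.piecewise a x) * walsh D x =
        if (∀ i ∈ D, x i = a i) then evalBool r a * walsh D a else 0 := by
      intro x; rw [hGx x]
      split_ifs with hx
      · rw [hwal x hx]
      · rw [zero_mul]
    simp_rw [this]
    rw [Finset.sum_ite, Finset.sum_const_zero, add_zero, Finset.sum_const, nsmul_eq_mul]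
  have hcard : ((Finset.univ.filter fun x : Fin N → Bool => ∀ i ∈ D, x i = a i).card : ℝ) ≠ 0 := by
    rw [Nat.cast_ne_zero]
    exact Finset.card_ne_zero.mpr ⟨a, Finset.mem_filter.mpr ⟨Finset.mem_univ _, fun i _ => rfl⟩⟩
  have h2 : (2 : ℝ) ^ N ≠ 0 := pow_ne_zero _ two_ne_zero
  unfold cubeFourierCoeff at hcoef
  rw [div_eq_zero_iff, or_iff_left h2, hsum] at hcoef
  rcases mul_eq_zero.mp hcoef with h | h
  · exact absurd h hcard
  rcases mul_eq_zero.mp h with h | h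
  · exact h
  · exfalso
    unfold walsh at h
    exact (Finset.prod_ne_zero_iff.mpr fun j _ => by cases a j <;> simp [sgn]) h

/-- **Subcube obstruction, upper side.** If `p = 1` at every point of a subcube of dimension `> T` (the points
agreeing with `a` outside `D`, `|D| > T`) except at `a`, where `p(a) ≠ 1`, then `p` is NOT pseudo-bounded of
order `T`: each `r_j` of a certificate `1 - p = Σ r_j²` (`deg r_j ≤ T < |D|`) vanishes on the subcube minus `a`,
hence at `a` (`evalBool_eq_zero_of_vanish_on_subcube`), forcing `p(a) = 1`. E.g. a Boolean function with an
`OR_{T+1}` subfunction, or the selector `y_k ? AND_k : OR_k` (`k > T`) on the face `y_k = 0`. [folklore] -/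
theorem not_pseudoBounded_of_isolated_lt_one {N T : ℕ} {p : MvPolynomial (Fin N) ℝ}
    (D : Finset (Fin N)) (hD : T < D.card) (a : Fin N → Bool)
    (h1 : ∀ x : Fin N → Bool, (∀ i, i ∉ D → x i = a i) → x ≠ a →
      MvPolynomial.eval (fun k => if x k then (1 : ℝ) else 0) p = 1)
    (ha : MvPolynomial.eval (fun k => if a k then (1 : ℝ) else 0) p ≠ 1) :
    ¬ PseudoBounded T p := by
  rintro ⟨m, q, r, hdeg, hval⟩
  have hvan : ∀ j, ∀ x : Fin N → Bool, (∀ i, i ∉ D → x i = a i) → x ≠ a → evalBool (r j) x = 0 := by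
    intro j x hx hxa
    have h := (hval x).2
    rw [h1 x hx hxa, sub_self] at h
    exact (pow_eq_zero_iff two_ne_zero).mp
      ((Finset.sum_eq_zero_iff_of_nonneg fun j _ => sq_nonneg _).mp h.symm j (Finset.mem_univ j))
  have hzero : ∀ j, evalBool (r j) a = 0 := fun j =>
    evalBool_eq_zero_of_vanish_on_subcube D (r j) ((hdeg j).2.trans_lt hD) a (hvan j)
  have h := (hval a).2
  have hsum0 : ∑ j, MvPolynomial.eval (fun k => if a k then (1 : ℝ) else 0) (r j) ^ 2 = 0 :=
    Finset.sum_eq_zero fun j _ => by have := hzero j; unfold evalBool at this; rw [this]; ring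
  rw [hsum0] at h
  exact ha (by linarith)

/-- **Subcube obstruction, lower side.** If `p = 0` at every point of a subcube of dimension `> T` except at
`a`, where `p(a) ≠ 0`, then `p` is NOT pseudo-bounded of order `T` (same argument with `p = Σ q_j²`). E.g. a
Boolean function with an `AND_{T+1}` subfunction — any point indicator of a `(T+1)`-subcube — is outside
`K_T` whatever its total degree: `K_T`-membership bounds the sum-of-squares degree (`= QE`,
Kaniewski–Lee–de Wolf Thm 12) of EVERY restriction of `p` and of `1 - p` by `T`. [folklore] -/
theorem not_pseudoBounded_of_isolated_pos {N T : ℕ} {p : MvPolynomial (Fin N) ℝ}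
    (D : Finset (Fin N)) (hD : T < D.card) (a : Fin N → Bool)
    (h0 : ∀ x : Fin N → Bool, (∀ i, i ∉ D → x i = a i) → x ≠ a →
      MvPolynomial.eval (fun k => if x k then (1 : ℝ) else 0) p = 0)
    (ha : MvPolynomial.eval (fun k => if a k then (1 : ℝ) else 0) p ≠ 0) :
    ¬ PseudoBounded T p := by
  rintro ⟨m, q, r, hdeg, hval⟩
  have hvan : ∀ j, ∀ x : Fin N → Bool, (∀ i, i ∉ D → x i = a i) → x ≠ a → evalBool (q j) x = 0 := by
    intro j x hx hxa
    have h := (hval x).1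
    rw [h0 x hx hxa] at h
    exact (pow_eq_zero_iff two_ne_zero).mp
      ((Finset.sum_eq_zero_iff_of_nonneg fun j _ => sq_nonneg _).mp h.symm j (Finset.mem_univ j))
  have hzero : ∀ j, evalBool (q j) a = 0 := fun j =>
    evalBool_eq_zero_of_vanish_on_subcube D (q j) ((hdeg j).1.trans_lt hD) a (hvan j)
  have h := (hval a).1
  have hsum0 : ∑ j, MvPolynomial.eval (fun k => if a k then (1 : ℝ) else 0) (q j) ^ 2 = 0 :=
    Finset.sum_eq_zero fun j _ => by have := hzero j; unfold evalBool at this; rw [this]; ring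
  rw [hsum0] at h
  exact ha h

/-- **Corollary: the `AND` function itself.** `AND_N = Π_i y_i` on `N ≥ 1` bits (a quantum acceptance
probability of an `N`-query algorithm, total degree `N`) is pseudo-bounded of order `T` only if `T ≥ N`:
it is the point indicator of the all-ones vertex of the whole cube. (So `K_T ∩ {Boolean}` excludes every
function with an `AND_{T+1}`-subcube, in line with the exact quantum query complexity of `AND_n` being `n`.)
[folklore] -/
theorem and_not_pseudoBounded {N T : ℕ} (hT : T < N) :
    ¬ PseudoBounded T (∏ i : Fin N, (X i : MvPolynomial (Fin N) ℝ)) := by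
  classical
  have hev : ∀ x : Fin N → Bool,
      MvPolynomial.eval (fun k => if x k then (1 : ℝ) else 0) (∏ i : Fin N, (X i : MvPolynomial (Fin N) ℝ)) =
        if (∀ i, x i = true) then 1 else 0 := by
    intro x
    rw [map_prod]; simp only [MvPolynomial.eval_X]; rw [Finset.prod_boole]
    by_cases h : ∀ i, x i = true
    · rw [if_pos h, if_pos (fun i _ => h i)]
    · rw [if_neg h, if_neg (fun h' => h (fun i => h' i (Finset.mem_univ i)))]
  refine not_pseudoBounded_of_isolated_pos Finset.univ (by rwa [Finset.card_univ, Fintype.card_fin])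
    (fun _ => true) (fun x _ hxa => ?_) (by rw [hev]; simp)
  rw [hev, if_neg]
  intro hall
  exact hxa (funext hall)

end Summit.QuantumAdvantage.QuantumAdvantage.Theorems.SosSandwich
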